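import Mathlib
import Literature.Probability.LatticeModels.ProdBernoulliIndependence
import Literature.Probability.Percolation.SharpnessDCTProofs
import Summits.CriticalPhenomena.PercolationContinuityZ3.Theorems.PercNearOneGluingNearOneGluingPocketBound
import Summits.CriticalPhenomena.PercolationContinuityZ3.Theorems.PercNearOneGluingNearOneGluingDepthOneGluing
import Summits.CriticalPhenomena.PercolationContinuityZ3.Theorems.PercNearOneGluingNearOneGluingKnLemma3i
import Summits.CriticalPhenomena.PercolationContinuityZ3.Theorems.PercNearOneGluingNearOneGluingSmallPocketsAux
import HarnessLib

/-!
# Crux `PercNearOneGluing.NearOneGluing` (stmt-CriticalPhenomena-4574), line `live-seal-vanishing-sprinkle`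
# — stub `stub_smallPockets` (small pockets are harmless)

Helper file for the crux skeleton `Cruxes/NearOneGluing/Lines/live-seal-vanishing-sprinkle.lean`
(lead prover-line-stmt-CriticalPhenomena-4574-a1-0).  Proves exactly the registered stub signature;
lands with `--supports stmt-CriticalPhenomena-4574`.  The combinatorics of rooted parent maps and
the real-variable inequalities are in the companion file
`PercNearOneGluingNearOneGluingSmallPocketsAux.lean`.

SMALL POCKETS ARE HARMLESS.  `μ = prodBernoulli w` on the bond configurations
`ω : Set (Sym2 (Fin n))` of the complete weighted graph on `Fin n`; relays `A ∌ o`, target `b`,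
`μ(a ↮ b) ≤ t` for `a ∈ A`; `P ω` the relay-free pocket of `o` (`v ∈ P ω ↔ o ↔ v` inside
`(↑A)ᶜ`).  For `0 < s < 1` and `k : ℕ`:
`μ{o ↮ b, o ↔ A, |P ω| = k} ≤ t ^ s · (1 - s)^{-(k-1)} · k ^ k`.

Proof.
* Partition by the value `S₀` of the pocket (`o ∈ S₀`, `S₀ ∩ A = ∅`, `|S₀| = k`).  Per pocket,
  `μ(bad ∩ {P = S₀}) ≤ t · μ(Span S₀)` (`pocket_term_le` with `depthOneGluing knLemma3i`,
  `Span S₀ = {∀ v ∈ S₀, o ↔ v inside S₀}`) and `μ(bad ∩ {P = S₀}) ≤ μ{P = S₀} ≤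
  μ(Span S₀ ∩ Cl S₀) = μ(Span S₀) · κ`, `Cl S₀ = {all boundary pairs closed}`,
  `κ = ∏_{∂S₀} (1 - w e)` (walk lemmas `mem_openConnIn_of_pocket`, `notMem_of_pocket`,
  independence); interpolating, `≤ t ^ s · κ ^ {1-s} · μ(Span S₀)`.
* Un-boosted weights `1 - w₁ = (1 - w)^{1-s}`: `κ^{1-s} = μ_{w₁}(Cl S₀)` and, by Bernoulli's
  inequality, `w ≤ w₁ / (1 - s)`.
* `Span S₀ ⊆ ⋃_p E_p` over the ROOTED PARENT MAPS `p` of `S₀` (`p v ∈ S₀`, some rank decreases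
  along `v ↦ p v` on `S₀ ∖ {o}`, `p = id` off `S₀`; at most `k ^ k` of them), where
  `E_p = {all pairs s(p v, v), v ∈ S₀ ∖ {o}, open}` is a cylinder on `≤ k - 1` pairs inside `S₀`;
  so `μ_w(E_p) ≤ (1-s)^{-(k-1)} μ_{w₁}(E_p)` and `μ_w(Span S₀) ≤ (1-s)^{-(k-1)} Σ_p μ_{w₁}(E_p)`.
* `μ_{w₁}(E_p) μ_{w₁}(Cl S₀) = μ_{w₁}(E_p ∩ Cl S₀)` (disjoint supports) and
  `E_p ∩ Cl S₀ ⊆ {P = S₀}` (tree pairs open ⇒ `S₀ ⊆` pocket; boundary closed ⇒ pocket `⊆ S₀`),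
  so the per-pocket bound is `≤ t^s (1-s)^{-(k-1)} k^k μ_{w₁}{P = S₀}`, and the events
  `{P = S₀}` are pairwise disjoint: `Σ_{S₀} μ_{w₁}{P = S₀} ≤ 1`.
-/

namespace Summit.CriticalPhenomena.PercolationContinuityZ3.Theorems

open scoped BigOperators Classical
open MeasureTheory Set
open Literature.Probability.LatticeModels (prodBernoulli prodBernoulli_real_inter_of_determinedBy
  prodBernoulli_real_inter_of_determinedBy_disjoint prodBernoulli_real_forall_notMem
  prodBernoulli_real_subset)
open Literature.Probability.Percolation

/-! ### The per-pocket bound -/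

section PerPocket

variable {n : ℕ}

/-- **Per-pocket bound.** For a pocket value `S₀ ∋ o` disjoint from `A`, with `k = |S₀|` and the
un-boosted weights `w₁`:
`μ_w({o ↔ A, o ↮ b} ∩ {pocket = S₀}) ≤ t^s (1-s)^{-(k-1)} k^k · μ_{w₁}{pocket = S₀}`. -/
theorem smallPockets_term_le (w : Sym2 (Fin n) → unitInterval) {A S₀ : Finset (Fin n)}
    {o b : Fin n} {t s : ℝ} (ht : 0 ≤ t) (hs0 : 0 < s) (hs1 : s < 1) (hoS : o ∈ S₀)
    (hSA : Disjoint S₀ A) (hrel : ∀ a ∈ A, (prodBernoulli w).real (openConn a b)ᶜ ≤ t)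
    {w₁ : Sym2 (Fin n) → unitInterval}
    (hw₁ : ∀ e, (w₁ e : ℝ) = 1 - (1 - (w e : ℝ)) ^ (1 - s)) :
    (prodBernoulli w).real (((⋃ a ∈ A, openConn o a) ∩ (openConn o b)ᶜ) ∩
        {ω | ∀ v : Fin n, ω ∈ openConnIn (↑A : Set (Fin n))ᶜ o v ↔ v ∈ S₀}) ≤
      t ^ s / (1 - s) ^ (S₀.card - 1) * (S₀.card : ℝ) ^ S₀.card *
        (prodBernoulli w₁).real
          {ω | ∀ v : Fin n, ω ∈ openConnIn (↑A : Set (Fin n))ᶜ o v ↔ v ∈ S₀} := by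
  set μ := prodBernoulli w with hμ
  set μ₁ := prodBernoulli w₁ with hμ₁
  set k := S₀.card with hk
  set Span : Set (Set (Sym2 (Fin n))) :=
    {ω | ∀ v ∈ S₀, ω ∈ openConnIn (↑S₀ : Set (Fin n)) o v} with hSpan
  set Pock : Set (Set (Sym2 (Fin n))) :=
    {ω | ∀ v : Fin n, ω ∈ openConnIn (↑A : Set (Fin n))ᶜ o v ↔ v ∈ S₀} with hPock
  set Bad : Set (Set (Sym2 (Fin n))) := (⋃ a ∈ A, openConn o a) ∩ (openConn o b)ᶜ with hBad
  obtain ⟨F₀, hF₀⟩ := exists_boundaryPairs S₀ A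
  set Cl : Set (Set (Sym2 (Fin n))) := {ω | ∀ e ∈ F₀, e ∉ ω} with hCl
  set κ : ℝ := ∏ e ∈ F₀, (1 - (w e : ℝ)) with hκdef
  -- rooted parent maps, tree pair sets and tree cylinders
  set Maps : Finset (Fin n → Fin n) := Finset.univ.filter fun p =>
      (∀ v ∈ S₀, p v ∈ S₀) ∧ (∀ v ∉ S₀, p v = v) ∧
        ∃ r : Fin n → ℕ, ∀ v ∈ S₀, v ≠ o → r (p v) < r v with hMaps
  set I : (Fin n → Fin n) → Finset (Sym2 (Fin n)) :=
    fun p => (S₀.erase o).image fun v => s(p v, v) with hI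
  set E : (Fin n → Fin n) → Set (Set (Sym2 (Fin n))) :=
    fun p => {ω | (↑(I p) : Set (Sym2 (Fin n))) ⊆ ω} with hE
  -- (a) depth-one gluing after contracting the pocket: `μ(Bad ∩ Pock) ≤ t μ(Span)`
  have hA : μ.real (Bad ∩ Pock) ≤ t * μ.real Span := by
    obtain ⟨π, hπ1, hπ2, hπ3⟩ := exists_mergeFiber S₀ A o hSA
    obtain ⟨w', hw'⟩ := exists_fiberWeights w π
    exact pocket_term_le (depthOneGluing knLemma3i) w ht hoS hSA hrel hπ1 hπ2 hπ3
      (Φ := fun ω => {k | ∃ e ∈ ω, π e = some k}) (fun _ _ => Iff.rfl) hw' hF₀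
  -- (b) `Pock ⊆ Span ∩ Cl`, independent events: `μ(Bad ∩ Pock) ≤ κ μ(Span)`
  have hF₀S : (↑F₀ : Set (Sym2 (Fin n))) ⊆ (↑S₀.sym2 : Set (Sym2 (Fin n)))ᶜ := by
    intro e he heS
    rw [Finset.mem_coe] at he heS
    revert he heS
    induction e using Sym2.ind with
    | _ x y =>
    intro he heS
    rw [Finset.mk_mem_sym2_iff] at heS
    rcases (hF₀ x y).1 he with ⟨-, hy, -⟩ | ⟨-, hx, -⟩
    exacts [hy heS.2, hx heS.1]
  have hClκ : μ.real Cl = κ := prodBernoulli_real_forall_notMem w F₀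
  have hB : μ.real (Bad ∩ Pock) ≤ κ * μ.real Span := by
    calc μ.real (Bad ∩ Pock) ≤ μ.real (Span ∩ Cl) :=
          measureReal_mono fun ω hω =>
            ⟨fun v hv => mem_openConnIn_of_pocket hω.2 hv, fun e he => notMem_of_pocket hF₀ hω.2 he⟩
      _ = μ.real Span * μ.real Cl :=
          prodBernoulli_real_inter_of_determinedBy w S₀.sym2 (determinedBy_span S₀ o)
            ((determinedBy_forall_notMem F₀).mono hF₀S) MeasurableSet.of_discrete
            MeasurableSet.of_discrete
      _ = κ * μ.real Span := by rw [hClκ, mul_comm]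
  -- interpolation
  have hκ0 : 0 ≤ κ := Finset.prod_nonneg fun e _ => sub_nonneg.2 (w e).2.2
  have hAB : μ.real (Bad ∩ Pock) ≤ t ^ s * κ ^ (1 - s) * μ.real Span :=
    smallPockets_interp measureReal_nonneg measureReal_nonneg hκ0 ht hs0 hs1 hA hB
  -- `κ ^ (1 - s) = μ₁(Cl)`
  have hκ1 : κ ^ (1 - s) = μ₁.real Cl := by
    have h1 : μ₁.real Cl = ∏ e ∈ F₀, (1 - (w₁ e : ℝ)) := prodBernoulli_real_forall_notMem w₁ F₀
    rw [h1, hκdef, ← Real.finsetProd_rpow F₀ (fun e => 1 - (w e : ℝ))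
      (fun e _ => sub_nonneg.2 (w e).2.2) (1 - s)]
    refine Finset.prod_congr rfl fun e _ => ?_
    rw [hw₁ e]
    ring
  -- covering of `Span` by the tree cylinders of the rooted parent maps
  have hcover : Span ⊆ ⋃ p ∈ Maps, E p := by
    intro ω hω
    obtain ⟨p, hp1, hp2, hp3, hp4⟩ :=
      smallPockets_exists_parent hoS (fun v hv => DCT16.pathIn_of_mem_openConnIn (hω v hv))
    have hpM : p ∈ Maps := by
      rw [hMaps, Finset.mem_filter]
      exact ⟨Finset.mem_univ _, hp1, hp2, hp3⟩
    have hωE : ω ∈ E p := smallPockets_subset_iff.2 hp4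
    exact Set.mem_iUnion₂.2 ⟨p, hpM, hωE⟩
  -- weight comparison on each tree cylinder (`≤ k - 1` pairs)
  have hEp : ∀ p ∈ Maps, μ.real (E p) ≤ μ₁.real (E p) / (1 - s) ^ (k - 1) := by
    intro p _
    have h1 : μ.real (E p) = ∏ e ∈ I p, (w e : ℝ) := prodBernoulli_real_subset w (I p)
    have h2 : μ₁.real (E p) = ∏ e ∈ I p, (w₁ e : ℝ) := prodBernoulli_real_subset w₁ (I p)
    rw [h1, h2]
    refine smallPockets_prod_le w hw₁ hs0 hs1 (I p) ?_
    calc (I p).card ≤ (S₀.erase o).card := Finset.card_image_le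
      _ = k - 1 := Finset.card_erase_of_mem hoS
  have hM : μ.real Span ≤ (∑ p ∈ Maps, μ₁.real (E p)) / (1 - s) ^ (k - 1) := by
    calc μ.real Span ≤ μ.real (⋃ p ∈ Maps, E p) := measureReal_mono hcover (measure_ne_top _ _)
      _ ≤ ∑ p ∈ Maps, μ.real (E p) := measureReal_biUnion_finset_le Maps E
      _ ≤ ∑ p ∈ Maps, μ₁.real (E p) / (1 - s) ^ (k - 1) := Finset.sum_le_sum hEp
      _ = (∑ p ∈ Maps, μ₁.real (E p)) / (1 - s) ^ (k - 1) := by rw [Finset.sum_div]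
  -- independence of the tree cylinder (pairs inside `S₀`) from `Cl` (boundary pairs)
  have hIS : ∀ p ∈ Maps, I p ⊆ S₀.sym2 := by
    intro p hp e he
    rw [hMaps, Finset.mem_filter] at hp
    obtain ⟨v, hv, rfl⟩ := Finset.mem_image.1 he
    rw [Finset.mk_mem_sym2_iff]
    exact ⟨hp.2.1 v (Finset.mem_of_mem_erase hv), Finset.mem_of_mem_erase hv⟩
  have hind : ∀ p ∈ Maps, μ₁.real (E p) * μ₁.real Cl = μ₁.real (E p ∩ Cl) := by
    intro p hp
    refine (prodBernoulli_real_inter_of_determinedBy_disjoint w₁ ?_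
      (smallPockets_determinedBy_subset (I p)) (determinedBy_forall_notMem F₀)
      MeasurableSet.of_discrete MeasurableSet.of_discrete).symm
    exact Finset.disjoint_left.2 fun e he heF =>
      hF₀S (Finset.mem_coe.2 heF) (Finset.mem_coe.2 (hIS p hp he))
  -- multiplicity: `E p ∩ Cl ⊆ Pock`
  have hincl : ∀ p ∈ Maps, E p ∩ Cl ⊆ Pock := by
    intro p hp ω hω
    rw [hMaps, Finset.mem_filter] at hp
    obtain ⟨-, hp1, -, r, hr⟩ := hp
    have htree : ∀ v ∈ S₀, v ≠ o → s(p v, v) ∈ ω := smallPockets_subset_iff.1 hω.1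
    exact smallPockets_pocket_of_tree hF₀ hoS hSA
      (smallPockets_pathIn_of_rank hoS hp1 hr htree) hω.2
  -- entropy
  have hcard : (Maps.card : ℝ) ≤ (k : ℝ) ^ k := by
    have h1 : Maps.card ≤ k ^ k := by
      refine le_trans (Finset.card_le_card fun p hp => ?_) (smallPockets_card_maps S₀)
      rw [hMaps, Finset.mem_filter] at hp
      rw [Finset.mem_filter]
      exact ⟨hp.1, hp.2.1, hp.2.2.1⟩
    exact_mod_cast h1
  -- assemble
  have hts : 0 ≤ t ^ s := Real.rpow_nonneg ht s
  have h1s : 0 < (1 - s) ^ (k - 1) := pow_pos (by linarith) _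
  have hC : 0 ≤ t ^ s / (1 - s) ^ (k - 1) := div_nonneg hts h1s.le
  calc μ.real (Bad ∩ Pock) ≤ t ^ s * κ ^ (1 - s) * μ.real Span := hAB
    _ = t ^ s * μ₁.real Cl * μ.real Span := by rw [hκ1]
    _ ≤ t ^ s * μ₁.real Cl * ((∑ p ∈ Maps, μ₁.real (E p)) / (1 - s) ^ (k - 1)) :=
        mul_le_mul_of_nonneg_left hM (mul_nonneg hts measureReal_nonneg)
    _ = t ^ s / (1 - s) ^ (k - 1) * ∑ p ∈ Maps, μ₁.real (E p) * μ₁.real Cl := by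
        rw [← Finset.sum_mul]; ring
    _ = t ^ s / (1 - s) ^ (k - 1) * ∑ p ∈ Maps, μ₁.real (E p ∩ Cl) := by
        rw [Finset.sum_congr rfl hind]
    _ ≤ t ^ s / (1 - s) ^ (k - 1) * ∑ p ∈ Maps, μ₁.real Pock :=
        mul_le_mul_of_nonneg_left
          (Finset.sum_le_sum fun p hp => measureReal_mono (hincl p hp)) hC
    _ = t ^ s / (1 - s) ^ (k - 1) * (Maps.card * μ₁.real Pock) := by
        rw [Finset.sum_const, nsmul_eq_mul]
    _ ≤ t ^ s / (1 - s) ^ (k - 1) * ((k : ℝ) ^ k * μ₁.real Pock) :=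
        mul_le_mul_of_nonneg_left (mul_le_mul_of_nonneg_right hcard measureReal_nonneg) hC
    _ = t ^ s / (1 - s) ^ (k - 1) * (k : ℝ) ^ k * μ₁.real Pock := by ring

end PerPocket

/-! ### The stub -/

/-- **Stub `stub_smallPockets` (small pockets are harmless).** For `o ∉ A`,
`max_a μ(a ↮ b) ≤ t`, every `k : ℕ` and every `s ∈ (0,1)`: the bad configurations
(`o ↮ b`, `o ↔ A`) whose relay-free pocket `P ω` has exactly `k` vertices have mass
`≤ t ^ s · (1 - s)^{-(k-1)} · k ^ k`.  See the module docstring for the proof. -/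
theorem stub_smallPockets (n : ℕ) (w : Sym2 (Fin n) → unitInterval) (A : Finset (Fin n))
    (o b : Fin n) (ho : o ∉ A) (t s : ℝ) (ht : 0 ≤ t) (hs0 : 0 < s) (hs1 : s < 1) (k : ℕ)
    (hrel : ∀ a ∈ A, (prodBernoulli w).real (openConn a b)ᶜ ≤ t)
    (P : Set (Sym2 (Fin n)) → Finset (Fin n))
    (hP : ∀ ω v, v ∈ P ω ↔ ω ∈ openConnIn ((↑A : Set (Fin n))ᶜ) o v) :
    (prodBernoulli w).real {ω | ω ∉ openConn o b ∧ (∃ a ∈ A, ω ∈ openConn o a) ∧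
        (P ω).card = k} ≤ t ^ s / (1 - s) ^ (k - 1) * (k : ℝ) ^ k := by
  obtain ⟨w₁, hw₁⟩ := smallPockets_exists_unboost w hs1
  set μ := prodBernoulli w with hμ
  set μ₁ := prodBernoulli w₁ with hμ₁
  set F : Finset (Finset (Fin n)) :=
    Finset.univ.filter fun S₀ => o ∈ S₀ ∧ Disjoint S₀ A ∧ S₀.card = k with hF
  set Bad : Set (Set (Sym2 (Fin n))) := (⋃ a ∈ A, openConn o a) ∩ (openConn o b)ᶜ with hBad
  set Pock : Finset (Fin n) → Set (Set (Sym2 (Fin n))) := fun S₀ =>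
    {ω | ∀ v : Fin n, ω ∈ openConnIn (↑A : Set (Fin n))ᶜ o v ↔ v ∈ S₀} with hPock
  set C : ℝ := t ^ s / (1 - s) ^ (k - 1) * (k : ℝ) ^ k with hC
  have hC0 : 0 ≤ C := by
    have h1 : 0 ≤ t ^ s := Real.rpow_nonneg ht s
    have h2 : 0 < (1 - s) ^ (k - 1) := pow_pos (by linarith) _
    have h3 : 0 ≤ (k : ℝ) ^ k := pow_nonneg (Nat.cast_nonneg k) k
    exact mul_nonneg (div_nonneg h1 h2.le) h3
  have hoU : o ∈ (↑A : Set (Fin n))ᶜ := fun h => ho (Finset.mem_coe.1 h)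
  -- partition according to the value of the pocket
  have hcover : {ω | ω ∉ openConn o b ∧ (∃ a ∈ A, ω ∈ openConn o a) ∧ (P ω).card = k} ⊆
      ⋃ S₀ ∈ F, (Bad ∩ Pock S₀) := by
    rintro ω ⟨hb, hA, hk⟩
    have hU : ω ∈ ⋃ a ∈ A, openConn o a := by simpa only [mem_iUnion, exists_prop] using hA
    have hBad' : ω ∈ Bad := ⟨hU, hb⟩
    have hPk : ω ∈ Pock (P ω) := fun v => (hP ω v).symm
    have hPF : P ω ∈ F := by
      rw [hF, Finset.mem_filter]
      refine ⟨Finset.mem_univ _, (hP ω o).2 ⟨hoU, hoU, SimpleGraph.Reachable.refl _⟩, ?_, hk⟩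
      refine Finset.disjoint_left.2 fun v hv hvA => ?_
      obtain ⟨-, hvU, -⟩ := (hP ω v).1 hv
      exact hvU (Finset.mem_coe.2 hvA)
    exact Set.mem_iUnion₂.2 ⟨P ω, hPF, hBad', hPk⟩
  -- per pocket value
  have hterm : ∀ S₀ ∈ F, μ.real (Bad ∩ Pock S₀) ≤ C * μ₁.real (Pock S₀) := by
    intro S₀ hS₀
    rw [hF, Finset.mem_filter] at hS₀
    obtain ⟨-, hoS, hSA, hSk⟩ := hS₀
    have h := smallPockets_term_le w ht hs0 hs1 hoS hSA hrel hw₁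
    rw [hSk] at h
    exact h
  -- the pocket values partition
  have hdisj : (↑F : Set (Finset (Fin n))).PairwiseDisjoint Pock := by
    intro S₀ _ S₁ _ hne
    refine Set.disjoint_left.2 fun ω h0 h1 => hne ?_
    ext v
    exact (h0 v).symm.trans (h1 v)
  have hsum : ∑ S₀ ∈ F, μ₁.real (Pock S₀) ≤ 1 := by
    rw [← measureReal_biUnion_finset hdisj fun _ _ => MeasurableSet.of_discrete]
    exact measureReal_le_one
  calc μ.real {ω | ω ∉ openConn o b ∧ (∃ a ∈ A, ω ∈ openConn o a) ∧ (P ω).card = k}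
      ≤ μ.real (⋃ S₀ ∈ F, (Bad ∩ Pock S₀)) := measureReal_mono hcover (measure_ne_top _ _)
    _ ≤ ∑ S₀ ∈ F, μ.real (Bad ∩ Pock S₀) := measureReal_biUnion_finset_le F _
    _ ≤ ∑ S₀ ∈ F, C * μ₁.real (Pock S₀) := Finset.sum_le_sum hterm
    _ = C * ∑ S₀ ∈ F, μ₁.real (Pock S₀) := by rw [Finset.mul_sum]
    _ ≤ C * 1 := mul_le_mul_of_nonneg_left hsum hC0
    _ = t ^ s / (1 - s) ^ (k - 1) * (k : ℝ) ^ k := by rw [mul_one]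

end Summit.CriticalPhenomena.PercolationContinuityZ3.Theorems
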